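import Summits.HubbardSuperconductivity.HubbardSuperconductivity.Theorems.AnisotropyChordTransferFibre3FinXDSide

/-!
# Route `AnisotropyChord` / H0 rotor rung: FIN per-`L` side-condition cell check, variant Z (no `Δ⁻ ≥ 0` conjunct)

`…Fibre3FinXDSide.sdOK` carries a conjunct `0 ≤ Δ⁻` (lower end of the cell's `Δ`-enclosure) that its soundness proof never uses and
that the certified cell adjacent to `Δ = 0` (whose `Δ`-enclosure straddles `0`) cannot pass.  This file is the same evaluator without
that conjunct: `sdOKz`, ★ `sdz_cell_sound` (same statement and proof as `sd_cell_sound`), the cover cell `sdCellAnyZ` and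
★ `sdz_cellAny_sound`.  The per-`L` GM₃ glue (`…FinXDGM3`) uses this variant.
Prover seat `hubbard-h0-rotor-p3` g7; helper for piece A = stmt-HubbardSuperconductivity-23918 of rung 19089 (`--supports`, helper class).
WHAT THIS IS NOT: nothing here proves superconductivity in the Hubbard model (rotor TARGET as worded stays FALSE, g15 verdict); the regime
clause of ONE conditional reduction, per `L`, per cell.  Tree imports only; no sorry, no new axioms.
-/

set_option linter.dupNamespace false
set_option autoImplicit false

namespace Summit.HubbardSuperconductivity.HubbardSuperconductivity.Theorems.AnisotropyChord.Transfer.Fibre3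

namespace FinXD

open scoped BigOperators
open Finset Hole2 FinCell FinXB

/-- ★ THE SIDE-CONDITION CERTIFICATE of the cell with constants `(c, bn/bd, aD)`: the regime `m ≥ 0` and
`fac·η·(aD + b/ρ) < c`, with the positivity side conditions of every reciprocal (as `sdOK`, without the superfluous `0 ≤ Δ⁻` conjunct, so that the cell
adjacent to `Δ = 0` can pass). -/
def sdOKz (L : ℕ) (la lb : ℤ) (c : ℚ) (bn bd : ℕ) (aD : ℚ) : Bool :=
  let E := xbEval L la lb
  let Sd := sdData L la lb bn bd aD
  groundCellCheck L la lb && xbScalOK L la lb && decide (0 < E.2.P.1) && decide (0 < bd) &&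
    decide (0 ≤ Sd.m.1) && decide (0 < Sd.gap.1) && decide (0 < Sd.g0n.1) && decide (0 < Sd.g0d.1) &&
    decide (0 < Sd.g0.1) && decide (0 < Sd.rho.1) && decide (((Sd.lhs.2 : ℤ) : ℚ) < c * (D : ℚ))

/-! ## Soundness -/

section sound

variable {L : ℕ} [NeZero L]

/-- ★ THE SIDE-CONDITION CHECK IS SOUND: for every ground profile of the cell, `0 ≤ mHole` and
`facMI·η_eff·(aD + (bn/bd)/(2 + cos(2π/L))) < c`. [folklore] -/
theorem sdz_cell_sound (hL : 5 ≤ L) {Δ lam2 : ℝ} (hΔ0 : 0 ≤ Δ) (hΔ1 : Δ < 1) {f : Tor L → ℝ}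
    (hf : IsGroundTwoMagnon L Δ lam2 f) {la lb : ℤ}
    (hla : (la : ℝ) ≤ lam2 * ((D : ℤ) : ℝ)) (hlb : lam2 * ((D : ℤ) : ℝ) ≤ (lb : ℝ))
    {c : ℚ} {bn bd : ℕ} {aD : ℚ} (hcert : sdOKz L la lb c bn bd aD = true) :
    0 ≤ mHole L Δ f ∧
      facMI L Δ f * etaEff L lam2 * ((aD : ℝ) + ((bn : ℝ) / bd) / (2 + Real.cos (2 * Real.pi / L))) < (c : ℝ) := by
  have hL3 : 3 ≤ L := by omega
  have hD := D_pos
  unfold sdOKz at hcert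
  simp only [Bool.and_eq_true, decide_eq_true_eq] at hcert
  obtain ⟨⟨⟨⟨⟨⟨⟨⟨⟨⟨hchk, hsc⟩, hP⟩, hbd⟩, hm0⟩, hgap⟩, hg0n⟩, hg0d⟩, hg0⟩, hrho⟩, hlhs⟩ := hcert
  have H : CellHyp (L := L) Δ lam2 f la lb := ⟨hL, hΔ0, hΔ1, hf, hla, hlb, hchk, hsc⟩
  obtain ⟨mlam, -, -, mdelta, -, -, -, -, -, -, meps⟩ := H.hS
  have mP := H.mem_objP
  have mQ := H.mem_objQ
  -- `T⁺ = 3λ₂ + Q/P`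
  have hPpos : 0 < PiNormSq L f := by
    have h1 : (0 : ℝ) < ((xbEval L la lb).2.P.1 : ℝ) := by exact_mod_cast hP
    nlinarith [mP.1]
  have hid := sum_piR_C0fn L hf.1
  have eT : Tplus L Δ f = 3 * lam2 + (∑ cc : Cfg L, piR L f cc * C0fn L Δ lam2 f cc) * (1 / PiNormSq L f) := by
    rw [hid]; field_simp; ring
  have mT : mem (Tplus L Δ f) (sdData L la lb bn bd aD).tplus := by
    unfold sdData; simp only
    rw [eT]
    have h3 := mem_iscale 3 mlam
    push_cast at h3
    exact mem_iadd h3 (mem_imul mQ (mem_iinv mP hP))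
  -- `m`
  have hV : ((L * L : ℕ) : ℝ) = (L : ℝ) ^ 2 := by push_cast; ring
  have hLpos : (0 : ℝ) < L := by exact_mod_cast (show 0 < L by omega)
  have hVV : (0 : ℤ) < (((L * L) * (L * L) : ℕ) : ℤ) := by positivity
  have mc2 : mem (1 - 5 / (L : ℝ) ^ 2 + 6 / ((L : ℝ) ^ 2) ^ 2)
      (idivn (iconst ((((L * L) * (L * L) : ℕ) : ℤ) - 5 * ((L * L : ℕ) : ℤ) + 6)) ((((L * L) * (L * L) : ℕ) : ℤ))) := by
    have h := mem_idivn (mem_iconst ((((L * L) * (L * L) : ℕ) : ℤ) - 5 * ((L * L : ℕ) : ℤ) + 6)) hVV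
    have hL0 : (L : ℝ) ≠ 0 := ne_of_gt hLpos
    have e : (((((L * L) * (L * L) : ℕ) : ℤ) - 5 * ((L * L : ℕ) : ℤ) + 6 : ℤ) : ℝ) / ((((L * L) * (L * L) : ℕ) : ℤ) : ℝ)
        = 1 - 5 / (L : ℝ) ^ 2 + 6 / ((L : ℝ) ^ 2) ^ 2 := by
      push_cast
      field_simp
    rw [← e]; exact_mod_cast h
  have mm : mem (mHole L Δ f) (sdData L la lb bn bd aD).m := by
    have h := mem_isub (mem_idivn (mem_imul meps mc2) (by norm_num : (0 : ℤ) < 2)) mT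
    unfold mHole
    have e : eps1 L * (1 - 5 / (L : ℝ) ^ 2 + 6 / ((L : ℝ) ^ 2) ^ 2) / 2
        = eps1 L * (1 - 5 / (L : ℝ) ^ 2 + 6 / ((L : ℝ) ^ 2) ^ 2) / ((2 : ℤ) : ℝ) := by norm_num
    rw [e]
    unfold sdData at h ⊢; simp only at h ⊢
    exact h
  -- regime `m ≥ 0`
  have hmnn : 0 ≤ mHole L Δ f := by
    have h1 : (0 : ℝ) ≤ (((sdData L la lb bn bd aD).m.1 : ℤ) : ℝ) := by exact_mod_cast hm0
    nlinarith [mm.1]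
  refine ⟨hmnn, ?_⟩
  -- `κ_E`, `ĝ₀`, `fac`
  have mgap : mem (2 * eps1 L - Tplus L Δ f) (sdData L la lb bn bd aD).gap := by
    have h := mem_isub (mem_iscale 2 meps) mT
    push_cast at h
    unfold sdData at h ⊢; simp only at h ⊢; exact h
  have mkap : mem (kappaE L Δ f) (imul (iscale 3 (xbEval L la lb).1.eps1) (iinv (sdData L la lb bn bd aD).gap)) := by
    unfold kappaE
    rw [div_eq_mul_one_div]
    have h3 := mem_iscale 3 meps
    push_cast at h3
    exact mem_imul h3 (mem_iinv mgap hgap)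
  have mg0n : mem (3 * (1 - Δ) + mHole L Δ f) (sdData L la lb bn bd aD).g0n := by
    have h := mem_iadd (mem_iscale 3 (mem_isub mem_one mdelta)) mm
    push_cast at h
    unfold sdData at h ⊢; simp only at h ⊢; exact h
  have mg0d : mem (3 + mHole L Δ f) (sdData L la lb bn bd aD).g0d := by
    have h := mem_iadd (mem_iconst 3) mm
    push_cast at h
    unfold sdData at h ⊢; simp only at h ⊢; exact h
  have mg0 : mem (g0hat L Δ f) (sdData L la lb bn bd aD).g0 := by
    unfold g0hat
    rw [div_eq_mul_one_div]
    have h := mem_imul mg0n (mem_iinv mg0d hg0d)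
    unfold sdData at h ⊢; simp only at h ⊢; exact h
  have mfac : mem (facMI L Δ f) (sdData L la lb bn bd aD).fac := by
    unfold facMI
    rw [div_eq_mul_one_div]
    have h := mem_iadd mem_one (mem_imul (mem_imul mkap mdelta) (mem_iinv mg0 hg0))
    unfold sdData at h ⊢; simp only at h ⊢; exact h
  -- `η`, `ρ`, the sum
  have mEta : mem (etaEff L lam2) (sdData L la lb bn bd aD).eta := by
    unfold etaEff
    have h := mem_idivn (mem_iscale (L * L) mlam) (by norm_num : (0 : ℤ) < 4)
    rw [hV] at h
    push_cast at h
    unfold sdData; simp only; exact h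
  have mrho : mem (2 + Real.cos (2 * Real.pi / L)) (sdData L la lb bn bd aD).rho := by
    have hc := mem_cosIv hL3 (show 1 < L by omega)
    have e : Real.cos (2 * Real.pi * (1 : ℕ) / L) = Real.cos (2 * Real.pi / L) := by push_cast; rw [mul_one]
    rw [e] at hc
    have h := mem_iadd (mem_iconst 2) hc
    push_cast at h
    unfold sdData; simp only
    rw [getIv_cosTab (show 1 < L by omega)]
    exact h
  have msum : mem ((aD : ℝ) + ((bn : ℝ) / bd) / (2 + Real.cos (2 * Real.pi / L)))
      (iadd (qIv aD) (imul (qIv ((bn : ℚ) / bd)) (iinv (sdData L la lb bn bd aD).rho))) := by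
    rw [div_eq_mul_one_div ((bn : ℝ) / bd)]
    have hb : mem ((bn : ℝ) / bd) (qIv ((bn : ℚ) / bd)) := by
      have := mem_qIv ((bn : ℚ) / bd); push_cast at this; exact this
    exact mem_iadd (mem_qIv aD) (mem_imul hb (mem_iinv mrho hrho))
  have mlhs : mem (facMI L Δ f * etaEff L lam2 * ((aD : ℝ) + ((bn : ℝ) / bd) / (2 + Real.cos (2 * Real.pi / L))))
      (sdData L la lb bn bd aD).lhs := by
    have h := mem_imul (mem_imul mfac mEta) msum
    unfold sdData at h ⊢; simp only at h ⊢; exact h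
  -- conclude
  have hup := mlhs.2
  have hc : ((((sdData L la lb bn bd aD).lhs.2 : ℤ) : ℚ) : ℝ) < ((c * (D : ℚ) : ℚ) : ℝ) := by exact_mod_cast hlhs
  push_cast at hc
  nlinarith [hup, hc, hD]

end sound

/-! ## The cover form -/

/-- one cell of the per-`L` side-condition check with constants `(c, bn, aD)`: numerator-vacuous, `Δ`-vacuous on either side of
`(0, Δ₁]`, or certified by `sdOK`. -/
def sdCellAnyZ (L : ℕ) (d1 : ℚ) (bd : ℕ) (la lb : ℤ) (t : ℚ × ℕ × ℚ) : Bool :=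
  (denCellPos L (cosTab L) la lb && decide ((numIv L la lb).2 < 0) && decide (0 ≤ (G0Iv L la lb).1)) ||
  (groundCellCheck L la lb &&
    (decide ((deltaIv L la lb).2 < 0) || decide (d1 * (D : ℚ) < (((deltaIv L la lb).1 : ℤ) : ℚ)))) ||
  sdOKz L la lb t.1 t.2.1 bd t.2.2

/-- ★ one side-condition cell: for a ground profile at `0 < Δ ≤ Δ₁ < 1` with `λ₂·D` in a cell passing `sdCellAny`,
`0 ≤ mHole` and `facMI·η_eff·(aD + (bn/bd)/(2 + cos θ)) < c`. [folklore] -/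
theorem sdz_cellAny_sound (L : ℕ) [NeZero L] (hL : 5 ≤ L) {d1 : ℚ} {bd : ℕ} {Δ lam2 : ℝ} (hΔ0 : 0 < Δ)
    (hΔd : Δ ≤ (d1 : ℝ)) (hΔ1 : Δ < 1) {f : Tor L → ℝ} (hf : IsGroundTwoMagnon L Δ lam2 f) {la lb : ℤ}
    (hla : (la : ℝ) ≤ lam2 * ((D : ℤ) : ℝ)) (hlb : lam2 * ((D : ℤ) : ℝ) ≤ (lb : ℝ)) {t : ℚ × ℕ × ℚ}
    (hok : sdCellAnyZ L d1 bd la lb t = true) :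
    0 ≤ mHole L Δ f ∧
      facMI L Δ f * etaEff L lam2 * ((t.2.2 : ℝ) + ((t.2.1 : ℝ) / bd) / (2 + Real.cos (2 * Real.pi / L))) < (t.1 : ℝ) := by
  have hL3 : 3 ≤ L := by omega
  have hD := D_pos
  have hlam : 0 < lam2 := lam2_pos L hL3 hΔ1 hf.1
  have hΔe : Δ = deltaOfLam L lam2 := ground_delta_eq L hL hΔ0.le hΔ1 hf
  unfold sdCellAnyZ at hok
  simp only [Bool.or_eq_true, Bool.and_eq_true, decide_eq_true_eq] at hok
  rcases hok with (⟨⟨hpos, hnum⟩, hG0⟩ | ⟨hgc, hvac⟩) | hcert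
  · exact (vacuous_of_num_neg (L := L) hL3 hlam hla hlb hpos hnum hG0 hΔ0 hΔ1 hΔe).elim
  · exfalso
    have hmd := mem_delta_cell L hL3 hlam hla hlb hgc
    rw [← hΔe] at hmd
    obtain ⟨hlo, hhi⟩ := hmd
    rcases hvac with hneg | hbig
    · have : ((((deltaIv L la lb).2 : ℤ)) : ℝ) < 0 := by exact_mod_cast hneg
      nlinarith
    · have hbig' : (d1 : ℝ) * ((D : ℤ) : ℝ) < ((((deltaIv L la lb).1 : ℤ)) : ℝ) := by
        have := hbig
        have e : (((D : ℚ)) : ℝ) = ((D : ℤ) : ℝ) := by norm_cast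
        rw [← e]; exact_mod_cast this
      nlinarith
  · exact sdz_cell_sound hL hΔ0.le hΔ1 hf hla hlb hcert

end FinXD

end Summit.HubbardSuperconductivity.HubbardSuperconductivity.Theorems.AnisotropyChord.Transfer.Fibre3
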